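import Literature.NumberTheory.Sieve.IwaniecAlmostPrimesWeightedSum
import Literature.NumberTheory.Sieve.IwaniecAlmostPrimesNumerics
import HarnessLib

/-!
# Iwaniec (1978): parity.S19 from Proposition 2 — the glue

H. Iwaniec, *Almost-primes represented by quadratic polynomials*, Invent. Math. **47** (1978)
171–188 [cite: IwaniecInventiones1978, Theorem p. 172 and §6].  Combines
`weightedSum_lower_of_prop2_of_numerics'` (`IwaniecAlmostPrimesWeightedSum.lean`: (2) from
Proposition 2, the linear-sieve functions and a numerical inequality) with
`IsLinearSieveFunctions.numerics` (`IwaniecAlmostPrimesNumerics.lean`: that inequality, proved)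
and the reduction of the first file:

* `weightedSum_lower_of_proposition2 : proposition2_upper → proposition2_lower → weightedSum_lower`;
* `setOf_isAtMostAlmostPrime_two_sq_add_one_infinite_of_proposition2 :
    proposition2_upper → proposition2_lower → parity.S19`.

So parity.S19 (`Literature.NumberTheory.Sieve.setOf_isAtMostAlmostPrime_two_sq_add_one_infinite`) rests on exactly
the two named halves of Iwaniec's Proposition 2 (p. 185), i.e. on his bilinear-remainder linear
sieve (Acta Arith. 37 (1980), Thm 1 = `lemma2_bilinearSieve`) and the level of distribution
`x^{16/15}` for `n² + 1` (Corollary of Proposition 1, ⇐ a corrected Lemma 4 ⇐ Hooley's bound for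
incomplete Kloosterman sums = Weil's estimate); every other step of the paper is proved.
-/

noncomputable section

namespace Literature.NumberTheory.Sieve.Iwaniec1978

/-! ### Conclusion: (2) and parity.S19 from Proposition 2 -/

/-- **Display (2) of Iwaniec 1978 from his Proposition 2 — PROVED:**
`proposition2_upper → proposition2_lower → weightedSum_lower`. [cite: IwaniecInventiones1978, §6] -/
theorem weightedSum_lower_of_proposition2 (h2u : proposition2_upper) (h2l : proposition2_lower) :
    weightedSum_lower :=
  weightedSum_lower_of_prop2_of_numerics' h2u h2l fun _ _ h => h.numerics

/-- **parity.S19 from Iwaniec's Proposition 2 — PROVED:** `Ω(n² + 1) ≤ 2` for infinitely many `n`,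
given the two halves of Proposition 2 (p. 185). [cite: IwaniecInventiones1978, Theorem p. 172] -/
theorem setOf_isAtMostAlmostPrime_two_sq_add_one_infinite_of_proposition2
    (h2u : proposition2_upper) (h2l : proposition2_lower) :
    setOf_isAtMostAlmostPrime_two_sq_add_one_infinite :=
  setOf_isAtMostAlmostPrime_two_sq_add_one_infinite_of_weightedSum_lower
    (weightedSum_lower_of_proposition2 h2u h2l)

end Literature.NumberTheory.Sieve.Iwaniec1978

end
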